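import Summits.QuantumFields.YangMills.Theorems.UnitScaleTiltProp7FlatSourcedMeanValue
import HarnessLib

/-!
# Line «poincare_lipschitz» on crux `HistoryTailL` (stmt-QuantumFields-19936), route crux `BlockLipschitzL` (stmt-QuantumFields-23533), K2 AT DEPTH —
# (R3) INTERIOR REGULARITY, LINEAR MODEL, SCALE-OPTIMISED: the flat sourced mean-value estimate of the tree at the OPTIMAL INTERMEDIATE SCALE
# `ℓ* = (M/θ)^{2/(d+2)} ∧ ℓ_max` ⟹ `sup² ≲ θ^{2d/(d+2)}·M^{4/(d+2)} + M²/ℓ_max^d + θ²` (d = 3: `|X| ≲ θ^{3/5}M^{2/5} + ℓ_max^{−3/2}M + θ`)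

Cell `ym3-torus` (YM ladder rung R3 = continuum SU(2) Yang–Mills on the three-torus — a RUNG, NOT the Clay problem: not d = 4, not infinite volume, not a
mass gap); width seat `ym3-torus-px7` gen 4, item (A) of LOCATE «(R3)-LIN» (19936 evidence #44), LEAD ym-ust-19936-w1 g7's word «(R3)-LIN … corollary file
GO» (2026-08-29T00:19:25Z).  Def-free; flat and LINEAR; `--supports stmt-QuantumFields-23533`.  Nothing here proves `hStab`, (R1)–(R4), a stub, `BlockLipschitzL`,
`HistoryTailL` or a summit statement.

WHY.  Card v1.25 (c) (R3): «U-div-free ∧ curl-small (both fields good) ⇒ `sup_{footprint}|X| ≲ (L^{j+1})^{−3/2}‖X‖_{ℓ²(box)} + O(θ)`» — what puts an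
orbit-minimising hierarchically good pair in the perturbative regime of (R4).  Its flat linear single-scale form IS in the tree:
✓`Prop7FlatSourcedMeanValue.sq_le_of_curl_diverg_bounds_torus` (w1-19200 g6): on every torus `T^{(j)}`, for every `ℓ ≥ 1`,
`X⟨x₀,μ⟩² ≤ 4K(ℓ)·‖X_μ‖²_{ℓ²(Q_{R(ℓ)})} + (4K(2R+1)^d + 2)(64·2^d·d·(c₁+c₂)(2R+1))²`, `K(ℓ) = 2^d(1+56d)^d(ℓ+1)^{−d}`, `R(ℓ) = ℓ + d(ℓ+2)`, i.e.
`sup² ≲ ℓ^{−d}·mass + ℓ²·θ²`, `θ := c₁ + c₂ = sup|curl| + sup|div|`.  Read at the natural scale `ℓ ≍ L^{j+1}` the source term is `L^{j+1}·θBal(K)` — small only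
for `j + 1 ≲ K/2` (LOCATE §2(a)); read at the OPTIMAL scale it is `θ^{d/(d+2)}·M^{2/(d+2)}`, which in `hStab`'s non-trivial regime `M < 2√(L^{j+1})/CS`,
`θ = 2θBal(K)` is `≲ γ^{3/10}·p^{3/5}·L^{(2(j+1)−3K)/10} ≪ 1` at EVERY depth `j + 1 ≤ K` (LOCATE §2(b)) — a j-uniform floor under (R4) using ONLY the level-0
window (the `O(θ)` form needs the windows at every height, LOCATE §3, sibling `PoincareLipschitzLinAvgCurlClosedForm`).

WHAT IS PROVED (sorry-free, no definition; `A_d := 4·2^d(1+56d)^d`, `E_d := (A_d·(6d+3)^d + 2)·(64·2^d·d·(6d+3))²`, written inline).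
* §1 numeric letters with a free `d` (`two_R_add_one_le`, `K_mul_pow_le`, `source_term_le`) and the two `rpow` identities `rpow_letter_sq`, `rpow_letter_div`
  (`t := (M/θ)^{2/(d+2)}`: `t²θ² = θ^{2d/(d+2)}M^{4/(d+2)} = M²/t^d`) + `le_of_rpow_le_one`.
* §2 ★ `sq_le_at_scale` — ✓`sq_le_of_curl_diverg_bounds_torus` at the centre (`ρ₀ = 0`, `z′ = 0`), hypotheses stated ONCE on the boxes of the largest scale
  `ℓ_max` and the mass replaced by any `M² ≥ Σ_{Q_{R(ℓ_max)}} X_μ²`, constants simplified: for every `1 ≤ ℓ ≤ ℓ_max`,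
  `X⟨x₀,μ⟩² ≤ A_d·(ℓ+1)^{−d}·M² + E_d·ℓ²·(c₁+c₂)²` (boxes nested by ✓`box_mono`).
* §3 ★★ `sq_le_scaleOptimised` — `ℓ_max ≥ 1`, `M ≥ 0` ⟹
  `X⟨x₀,μ⟩² ≤ A_d·(ℓ_max+1)^{−d}·M² + (A_d + 4E_d)·(c₁+c₂)^{2d/(d+2)}·M^{4/(d+2)} + (A_d + E_d)·(c₁+c₂)²`
  (three cases on `t = (M/θ)^{2/(d+2)}`: `t ≤ 1` → `ℓ = 1`; `t ≥ ℓ_max` → `ℓ = ℓ_max`; else `ℓ = ⌈t⌉`; `θ = 0` → `ℓ = ℓ_max`).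
READING (d = 3, footprint point `x₀`, `ℓ_max ≍ L^{j+1}`, hypotheses on `transl x₀ '' Q_{4ℓ_max+8}(0)` ⊂ the `17·L^{j+1}` box): taking square roots,
`|X⟨x₀,μ⟩| ≤ C·((c₁+c₂)^{3/5}·M^{2/5} + (ℓ_max+1)^{−3/2}·M + (c₁+c₂))`, `C` absolute.  SHARPNESS of the exponent `2/5` (LOCATE §2(c), no height windows): the
azimuthal witness has `sup ≍ θ₀ρ`, `M ≍ θ₀ρ^{5/2}`, so `θ₀^{3/5}M^{2/5} ≍ θ₀ρ` for every `ρ`.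

HONEST SCOPE.  [folklore] corollary of the tree's lattice De Giorgi ∕ Campanato road ([Giaquinta1984] Ch. III) by real optimisation; no new analysis; the height
windows, the covariant∕nonlinear (R3) and (R4) are untouched.
-/

set_option autoImplicit false

noncomputable section

open scoped BigOperators
open Finset

namespace Summit.QuantumFields.YangMills.Theorems.PoincareLipschitzInteriorSupScaleOptimised

open Literature.MathematicalPhysics.QuantumFieldTheory.Balaban1983to89
open B4Eq19LatticeOperators
open LatticeFieldCalculus (curl diverg)
open B10Eq27TorusAxialLog (transl transl_zero)
open Summit.QuantumFields.YangMills.Theorems.Prop7FlatSourcedMeanValue (sq_le_of_curl_diverg_bounds_torus)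

/-! ## §1 Numeric letters (free `d`) -/

section Numeric

/-- `2R+1 ≤ (6d+3)·ℓ` for `R = ℓ + d(ℓ+2)`, `ℓ ≥ 1`. [folklore] -/
theorem two_R_add_one_le (d ℓ : ℕ) (hℓ : 1 ≤ ℓ) :
    (2 * ((0 + ℓ + d * ((ℓ : ℤ) + 2) : ℤ) : ℝ) + 1) ≤ (6 * d + 3 : ℝ) * ℓ := by
  push_cast
  have h1 : (1 : ℝ) ≤ ℓ := by exact_mod_cast hℓ
  have hd : (0 : ℝ) ≤ d := by positivity
  nlinarith

/-- `K(ℓ)·(2R+1)^d ≤ 2^d(1+56d)^d(6d+3)^d`. [folklore] -/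
theorem K_mul_pow_le (d ℓ : ℕ) (hℓ : 1 ≤ ℓ) :
    (2 : ℝ) ^ d * (1 + 56 * d) ^ d / ((ℓ : ℝ) + 1) ^ d * (2 * ((0 + ℓ + d * ((ℓ : ℤ) + 2) : ℤ) : ℝ) + 1) ^ d ≤
      (2 : ℝ) ^ d * (1 + 56 * d) ^ d * (6 * d + 3) ^ d := by
  have h1 := two_R_add_one_le d ℓ hℓ
  have hℓ1 : (0 : ℝ) < (ℓ : ℝ) + 1 := by positivity
  have h63 : (0 : ℝ) ≤ 6 * d + 3 := by positivity
  have h2 : (2 * ((0 + ℓ + d * ((ℓ : ℤ) + 2) : ℤ) : ℝ) + 1) ≤ (6 * d + 3 : ℝ) * ((ℓ : ℝ) + 1) :=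
    h1.trans (by nlinarith)
  have h0 : 0 ≤ (2 * ((0 + ℓ + d * ((ℓ : ℤ) + 2) : ℤ) : ℝ) + 1) := by push_cast; positivity
  have h3 : (2 * ((0 + ℓ + d * ((ℓ : ℤ) + 2) : ℤ) : ℝ) + 1) / ((ℓ : ℝ) + 1) ≤ 6 * d + 3 := by
    rw [div_le_iff₀ hℓ1]; exact h2
  have h4 : 0 ≤ (2 * ((0 + ℓ + d * ((ℓ : ℤ) + 2) : ℤ) : ℝ) + 1) / ((ℓ : ℝ) + 1) := div_nonneg h0 hℓ1.le
  calc (2 : ℝ) ^ d * (1 + 56 * d) ^ d / ((ℓ : ℝ) + 1) ^ d * (2 * ((0 + ℓ + d * ((ℓ : ℤ) + 2) : ℤ) : ℝ) + 1) ^ d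
      = (2 : ℝ) ^ d * (1 + 56 * d) ^ d * ((2 * ((0 + ℓ + d * ((ℓ : ℤ) + 2) : ℤ) : ℝ) + 1) / ((ℓ : ℝ) + 1)) ^ d := by
        rw [div_pow]; field_simp
    _ ≤ (2 : ℝ) ^ d * (1 + 56 * d) ^ d * (6 * d + 3) ^ d := by
        gcongr

/-- **The source term at scale `ℓ`**: `(4K(2R+1)^d + 2)(64·2^d·d·θ·(2R+1))² ≤ E_d·ℓ²·θ²`. [folklore] -/
theorem source_term_le (d ℓ : ℕ) (hℓ : 1 ≤ ℓ) {θ : ℝ} (hθ : 0 ≤ θ) :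
    (4 * ((2 : ℝ) ^ d * (1 + 56 * d) ^ d / ((ℓ : ℝ) + 1) ^ d) * (2 * ((0 + ℓ + d * ((ℓ : ℤ) + 2) : ℤ) : ℝ) + 1) ^ d + 2) *
        (64 * (2 : ℝ) ^ d * d * θ * (2 * ((0 + ℓ + d * ((ℓ : ℤ) + 2) : ℤ) : ℝ) + 1)) ^ 2 ≤
      ((4 * ((2 : ℝ) ^ d * (1 + 56 * d) ^ d * (6 * d + 3) ^ d) + 2) * (64 * (2 : ℝ) ^ d * d * (6 * d + 3)) ^ 2) * (ℓ : ℝ) ^ 2 * θ ^ 2 := by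
  have hK := K_mul_pow_le d ℓ hℓ
  have hS := two_R_add_one_le d ℓ hℓ
  have h0 : 0 ≤ (2 * ((0 + ℓ + d * ((ℓ : ℤ) + 2) : ℤ) : ℝ) + 1) := by push_cast; positivity
  set S : ℝ := (2 * ((0 + ℓ + d * ((ℓ : ℤ) + 2) : ℤ) : ℝ) + 1) with hSdef
  set κ : ℝ := (2 : ℝ) ^ d * (1 + 56 * d) ^ d * (6 * d + 3) ^ d with hκ
  have hK' : 4 * ((2 : ℝ) ^ d * (1 + 56 * d) ^ d / ((ℓ : ℝ) + 1) ^ d) * S ^ d + 2 ≤ 4 * κ + 2 := by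
    have : (2 : ℝ) ^ d * (1 + 56 * d) ^ d / ((ℓ : ℝ) + 1) ^ d * S ^ d ≤ κ := hK
    linarith
  have hK0 : 0 ≤ 4 * ((2 : ℝ) ^ d * (1 + 56 * d) ^ d / ((ℓ : ℝ) + 1) ^ d) * S ^ d + 2 := by positivity
  have hsq : (64 * (2 : ℝ) ^ d * d * θ * S) ^ 2 ≤ (64 * (2 : ℝ) ^ d * d * (6 * d + 3)) ^ 2 * (ℓ : ℝ) ^ 2 * θ ^ 2 := by
    have e : (64 * (2 : ℝ) ^ d * d * (6 * d + 3)) ^ 2 * (ℓ : ℝ) ^ 2 * θ ^ 2 = (64 * (2 : ℝ) ^ d * d * θ * ((6 * d + 3) * ℓ)) ^ 2 := by ring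
    rw [e]
    have ha : 0 ≤ 64 * (2 : ℝ) ^ d * d * θ := by positivity
    have h1 : 64 * (2 : ℝ) ^ d * d * θ * S ≤ 64 * (2 : ℝ) ^ d * d * θ * ((6 * d + 3) * ℓ) := mul_le_mul_of_nonneg_left hS ha
    have h2 : 0 ≤ 64 * (2 : ℝ) ^ d * d * θ * S := mul_nonneg ha h0
    exact pow_le_pow_left₀ h2 h1 2
  calc (4 * ((2 : ℝ) ^ d * (1 + 56 * d) ^ d / ((ℓ : ℝ) + 1) ^ d) * S ^ d + 2) * (64 * (2 : ℝ) ^ d * d * θ * S) ^ 2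
      ≤ (4 * κ + 2) * ((64 * (2 : ℝ) ^ d * d * (6 * d + 3)) ^ 2 * (ℓ : ℝ) ^ 2 * θ ^ 2) :=
        mul_le_mul hK' hsq (sq_nonneg _) (by positivity)
    _ = ((4 * κ + 2) * (64 * (2 : ℝ) ^ d * d * (6 * d + 3)) ^ 2) * (ℓ : ℝ) ^ 2 * θ ^ 2 := by ring

/-- `t² θ² = θ^{2d/(d+2)}·M^{4/(d+2)}` for `t = (M/θ)^{2/(d+2)}`. [folklore] -/
theorem rpow_letter_sq (d : ℕ) {θ M : ℝ} (hθ : 0 < θ) (hM : 0 ≤ M) :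
    ((M / θ) ^ ((2 : ℝ) / (d + 2))) ^ 2 * θ ^ 2 = θ ^ ((2 * d : ℝ) / (d + 2)) * M ^ ((4 : ℝ) / (d + 2)) := by
  have hd2 : (0 : ℝ) < d + 2 := by positivity
  have hMθ : 0 ≤ M / θ := div_nonneg hM hθ.le
  have e1 : ((M / θ) ^ ((2 : ℝ) / (d + 2))) ^ 2 = (M / θ) ^ ((4 : ℝ) / (d + 2)) := by
    rw [← Real.rpow_natCast, ← Real.rpow_mul hMθ]; congr 1; push_cast; ring
  rw [e1, Real.div_rpow hM hθ.le]
  have e2 : θ ^ 2 / θ ^ ((4 : ℝ) / (d + 2)) = θ ^ ((2 * d : ℝ) / (d + 2)) := by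
    rw [← Real.rpow_natCast θ 2, ← Real.rpow_sub hθ]; congr 1; push_cast; field_simp; ring
  rw [← e2]
  ring

/-- `M²/t^d = θ^{2d/(d+2)}·M^{4/(d+2)}` for `t = (M/θ)^{2/(d+2)}`, `M > 0`. [folklore] -/
theorem rpow_letter_div (d : ℕ) {θ M : ℝ} (hθ : 0 < θ) (hM : 0 < M) :
    M ^ 2 / ((M / θ) ^ ((2 : ℝ) / (d + 2))) ^ d = θ ^ ((2 * d : ℝ) / (d + 2)) * M ^ ((4 : ℝ) / (d + 2)) := by
  have hd2 : (0 : ℝ) < d + 2 := by positivity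
  have hMθ : 0 ≤ M / θ := div_nonneg hM.le hθ.le
  have e1 : ((M / θ) ^ ((2 : ℝ) / (d + 2))) ^ d = (M / θ) ^ ((2 * d : ℝ) / (d + 2)) := by
    rw [← Real.rpow_natCast, ← Real.rpow_mul hMθ]; congr 1; ring
  rw [e1, Real.div_rpow hM.le hθ.le, div_div_eq_mul_div]
  have e2 : M ^ 2 * θ ^ ((2 * d : ℝ) / (d + 2)) / M ^ ((2 * d : ℝ) / (d + 2)) =
      θ ^ ((2 * d : ℝ) / (d + 2)) * (M ^ 2 / M ^ ((2 * d : ℝ) / (d + 2))) := by ring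
  rw [e2, ← Real.rpow_natCast M 2, ← Real.rpow_sub hM]
  congr 2; push_cast; field_simp; ring

/-- `t ≤ 1 ⇒ M ≤ θ` for `t = (M/θ)^{2/(d+2)}`, `θ > 0`. [folklore] -/
theorem le_of_rpow_le_one (d : ℕ) {θ M : ℝ} (hθ : 0 < θ) (h : (M / θ) ^ ((2 : ℝ) / (d + 2)) ≤ 1) : M ≤ θ := by
  by_contra hlt
  have hlt : θ < M := lt_of_not_ge hlt
  have h1 : 1 < M / θ := by rw [lt_div_iff₀ hθ, one_mul]; exact hlt
  have he : (0 : ℝ) < 2 / (d + 2) := by positivity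
  have := Real.one_lt_rpow h1 he
  linarith

/-- The radii `R(ℓ) + e = ℓ + d(ℓ+2) + e` are monotone in `ℓ`. [folklore] -/
theorem radius_mono (d : ℕ) {ℓ ℓ' : ℕ} (h : ℓ ≤ ℓ') (e : ℤ) :
    (0 + ℓ + d * ((ℓ : ℤ) + 2) + e : ℤ) ≤ (0 + ℓ' + d * ((ℓ' : ℤ) + 2) + e : ℤ) := by
  have h1 : (ℓ : ℤ) ≤ ℓ' := by exact_mod_cast h
  have hd : (0 : ℤ) ≤ d := by positivity
  nlinarith

end Numeric

/-! ## §2 The tree lemma at one scale `ℓ ≤ ℓ_max`, hypotheses on the largest boxes -/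

section Torus

variable {P : Params} {j : ℕ}

/-- ★ **THE SOURCED MEAN-VALUE ESTIMATE AT SCALE `ℓ ≤ ℓ_max`, HYPOTHESES ON THE `ℓ_max` BOXES, SIMPLIFIED CONSTANTS.**  `d ≥ 1`; `|curl 1 X| ≤ c₁` on the
plaquettes based in `transl x₀ '' Q_{R(ℓ_max)+1}(0)` and `|diverg 1 X| ≤ c₂` on `transl x₀ '' Q_{R(ℓ_max)+2}(0)`, `R(ℓ) = ℓ + d(ℓ+2)`; `M² ≥ Σ_{Q_{R(ℓ_max)}(0)} X⟨transl x₀ w,μ⟩²`.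
Then for every `1 ≤ ℓ ≤ ℓ_max`: `X⟨x₀,μ⟩² ≤ A_d·(ℓ+1)^{−d}·M² + E_d·ℓ²·(c₁+c₂)²`. [folklore] [cite: Giaquinta1984, Ch. III §2 (2.5) p.78] -/
theorem sq_le_at_scale (hd : 1 ≤ P.d) (x₀ : Site P j) (X : PBond P j → ℝ) {ℓmax ℓ : ℕ} (hℓ : 1 ≤ ℓ) (hℓmax : ℓ ≤ ℓmax)
    {c₁ c₂ : ℝ} (hc₁ : 0 ≤ c₁) (hc₂ : 0 ≤ c₂)
    (hC : ∀ w ∈ box (0 : Zd P.d) (0 + ℓmax + P.d * ((ℓmax : ℤ) + 2) + 1), ∀ (ν μ : Fin P.d) (hνμ : ν < μ),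
      |curl 1 X ⟨transl x₀ w, ν, μ, hνμ⟩| ≤ c₁)
    (hDv : ∀ w ∈ box (0 : Zd P.d) (0 + ℓmax + P.d * ((ℓmax : ℤ) + 2) + 2), |diverg 1 X (transl x₀ w)| ≤ c₂)
    (μ : Fin P.d) {M : ℝ}
    (hM : ∑ w ∈ box (0 : Zd P.d) (0 + ℓmax + P.d * ((ℓmax : ℤ) + 2)), X ⟨transl x₀ w, μ⟩ ^ 2 ≤ M ^ 2) :
    X ⟨x₀, μ⟩ ^ 2 ≤
      4 * ((2 : ℝ) ^ P.d * (1 + 56 * P.d) ^ P.d) / ((ℓ : ℝ) + 1) ^ P.d * M ^ 2 +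
        ((4 * ((2 : ℝ) ^ P.d * (1 + 56 * P.d) ^ P.d * (6 * P.d + 3) ^ P.d) + 2) * (64 * (2 : ℝ) ^ P.d * P.d * (6 * P.d + 3)) ^ 2) *
          (ℓ : ℝ) ^ 2 * (c₁ + c₂) ^ 2 := by
  have hz : (0 : Zd P.d) ∈ box (0 : Zd P.d) (0 : ℤ) := mem_box.2 fun i => by simp
  have h := sq_le_of_curl_diverg_bounds_torus hd x₀ X hℓ (le_refl (0 : ℤ)) hc₁ hc₂
    (fun w hw ν μ' hνμ => hC w (box_mono 0 (radius_mono P.d hℓmax 1) hw) ν μ' hνμ)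
    (fun w hw => hDv w (box_mono 0 (radius_mono P.d hℓmax 2) hw)) hz μ
  rw [transl_zero] at h
  -- the mass term
  have hmass : ∑ w ∈ box (0 : Zd P.d) (0 + ℓ + P.d * ((ℓ : ℤ) + 2)), X ⟨transl x₀ w, μ⟩ ^ 2 ≤ M ^ 2 := by
    refine le_trans ?_ hM
    have hsub := box_mono (0 : Zd P.d) (radius_mono P.d hℓmax 0)
    simp only [add_zero] at hsub
    exact Finset.sum_le_sum_of_subset_of_nonneg hsub fun _ _ _ => sq_nonneg _
  have hK0 : 0 ≤ 4 * ((2 : ℝ) ^ P.d * (1 + 56 * P.d) ^ P.d / ((ℓ : ℝ) + 1) ^ P.d) := by positivity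
  have hsrc := source_term_le P.d ℓ hℓ (add_nonneg hc₁ hc₂)
  have e : 4 * ((2 : ℝ) ^ P.d * (1 + 56 * P.d) ^ P.d) / ((ℓ : ℝ) + 1) ^ P.d * M ^ 2 =
      4 * ((2 : ℝ) ^ P.d * (1 + 56 * P.d) ^ P.d / ((ℓ : ℝ) + 1) ^ P.d) * M ^ 2 := by ring
  rw [e]
  calc X ⟨x₀, μ⟩ ^ 2 ≤ _ := h
    _ ≤ 4 * ((2 : ℝ) ^ P.d * (1 + 56 * P.d) ^ P.d / ((ℓ : ℝ) + 1) ^ P.d) * M ^ 2 +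
        ((4 * ((2 : ℝ) ^ P.d * (1 + 56 * P.d) ^ P.d * (6 * P.d + 3) ^ P.d) + 2) * (64 * (2 : ℝ) ^ P.d * P.d * (6 * P.d + 3)) ^ 2) *
          (ℓ : ℝ) ^ 2 * (c₁ + c₂) ^ 2 := add_le_add (mul_le_mul_of_nonneg_left hmass hK0) hsrc

/-! ## §3 The scale-optimised estimate -/

/-- ★★ **(R3)-LIN, SCALE-OPTIMISED.**  Under the hypotheses of `sq_le_at_scale` (on the `ℓ_max` boxes), with `θ := c₁ + c₂` and `M ≥ 0`:
`X⟨x₀,μ⟩² ≤ A_d·(ℓ_max+1)^{−d}·M² + (A_d + 4E_d)·θ^{2d/(d+2)}·M^{4/(d+2)} + (A_d + E_d)·θ²` — the tree's single-scale estimate at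
`ℓ* = ⌈(M/θ)^{2/(d+2)}⌉` clamped to `[1, ℓ_max]` (`θ = 0`: `ℓ = ℓ_max`).  d = 3: `sup ≲ θ^{3/5}M^{2/5} + ℓ_max^{−3/2}M + θ`. [folklore]
[cite: Giaquinta1984, Ch. III §2 (2.5) p.78] -/
theorem sq_le_scaleOptimised (hd : 1 ≤ P.d) (x₀ : Site P j) (X : PBond P j → ℝ) {ℓmax : ℕ} (hℓmax : 1 ≤ ℓmax)
    {c₁ c₂ : ℝ} (hc₁ : 0 ≤ c₁) (hc₂ : 0 ≤ c₂)
    (hC : ∀ w ∈ box (0 : Zd P.d) (0 + ℓmax + P.d * ((ℓmax : ℤ) + 2) + 1), ∀ (ν μ : Fin P.d) (hνμ : ν < μ),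
      |curl 1 X ⟨transl x₀ w, ν, μ, hνμ⟩| ≤ c₁)
    (hDv : ∀ w ∈ box (0 : Zd P.d) (0 + ℓmax + P.d * ((ℓmax : ℤ) + 2) + 2), |diverg 1 X (transl x₀ w)| ≤ c₂)
    (μ : Fin P.d) {M : ℝ} (hM0 : 0 ≤ M)
    (hM : ∑ w ∈ box (0 : Zd P.d) (0 + ℓmax + P.d * ((ℓmax : ℤ) + 2)), X ⟨transl x₀ w, μ⟩ ^ 2 ≤ M ^ 2) :
    X ⟨x₀, μ⟩ ^ 2 ≤
      4 * ((2 : ℝ) ^ P.d * (1 + 56 * P.d) ^ P.d) / ((ℓmax : ℝ) + 1) ^ P.d * M ^ 2 +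
        (4 * ((2 : ℝ) ^ P.d * (1 + 56 * P.d) ^ P.d) +
            4 * (((4 * ((2 : ℝ) ^ P.d * (1 + 56 * P.d) ^ P.d * (6 * P.d + 3) ^ P.d) + 2) *
              (64 * (2 : ℝ) ^ P.d * P.d * (6 * P.d + 3)) ^ 2))) *
          ((c₁ + c₂) ^ ((2 * P.d : ℝ) / (P.d + 2)) * M ^ ((4 : ℝ) / (P.d + 2))) +
        (4 * ((2 : ℝ) ^ P.d * (1 + 56 * P.d) ^ P.d) +
            ((4 * ((2 : ℝ) ^ P.d * (1 + 56 * P.d) ^ P.d * (6 * P.d + 3) ^ P.d) + 2) *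
              (64 * (2 : ℝ) ^ P.d * P.d * (6 * P.d + 3)) ^ 2)) * (c₁ + c₂) ^ 2 := by
  -- letters
  set A : ℝ := 4 * ((2 : ℝ) ^ P.d * (1 + 56 * P.d) ^ P.d) with hA
  set E : ℝ := ((4 * ((2 : ℝ) ^ P.d * (1 + 56 * P.d) ^ P.d * (6 * P.d + 3) ^ P.d) + 2) *
    (64 * (2 : ℝ) ^ P.d * P.d * (6 * P.d + 3)) ^ 2) with hE
  set θ : ℝ := c₁ + c₂ with hθ
  set Φ : ℝ := θ ^ ((2 * P.d : ℝ) / (P.d + 2)) * M ^ ((4 : ℝ) / (P.d + 2)) with hΦ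
  have hA0 : 0 ≤ A := by positivity
  have hE0 : 0 ≤ E := by positivity
  have hθ0 : 0 ≤ θ := add_nonneg hc₁ hc₂
  have hΦ0 : 0 ≤ Φ := mul_nonneg (Real.rpow_nonneg hθ0 _) (Real.rpow_nonneg hM0 _)
  have hℓmax0 : (0 : ℝ) < (ℓmax : ℝ) + 1 := by positivity
  -- the scale-`ℓ` estimate in letters
  have step : ∀ ℓ : ℕ, 1 ≤ ℓ → ℓ ≤ ℓmax → X ⟨x₀, μ⟩ ^ 2 ≤ A / ((ℓ : ℝ) + 1) ^ P.d * M ^ 2 + E * (ℓ : ℝ) ^ 2 * θ ^ 2 := by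
    intro ℓ h1 h2
    have h := sq_le_at_scale hd x₀ X h1 h2 hc₁ hc₂ hC hDv μ hM
    rw [← hA, ← hE, ← hθ] at h
    exact h
  -- target in letters
  show X ⟨x₀, μ⟩ ^ 2 ≤ A / ((ℓmax : ℝ) + 1) ^ P.d * M ^ 2 + (A + 4 * E) * Φ + (A + E) * θ ^ 2
  have hT1 : 0 ≤ A / ((ℓmax : ℝ) + 1) ^ P.d * M ^ 2 := by positivity
  have hT2 : 0 ≤ (A + 4 * E) * Φ := by positivity
  have hT3 : 0 ≤ (A + E) * θ ^ 2 := by positivity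
  by_cases hθz : θ = 0
  · -- no sources: the largest scale
    have h := step ℓmax hℓmax le_rfl
    have h' : E * (ℓmax : ℝ) ^ 2 * θ ^ 2 = 0 := by rw [hθz]; ring
    linarith [hT2, hT3]
  have hθpos : 0 < θ := lt_of_le_of_ne hθ0 (Ne.symm hθz)
  set t : ℝ := (M / θ) ^ ((2 : ℝ) / (P.d + 2)) with ht
  have ht0 : 0 ≤ t := Real.rpow_nonneg (div_nonneg hM0 hθpos.le) _
  have hsq : t ^ 2 * θ ^ 2 = Φ := by rw [ht, hΦ]; exact rpow_letter_sq P.d hθpos hM0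
  by_cases ht1 : t ≤ 1
  · -- scale 1: `M ≤ θ`
    have hMθ : M ≤ θ := le_of_rpow_le_one P.d hθpos ht1
    have h := step 1 le_rfl hℓmax
    have h1 : A / (((1 : ℕ) : ℝ) + 1) ^ P.d * M ^ 2 ≤ A * θ ^ 2 := by
      have hden : (1 : ℝ) ≤ (((1 : ℕ) : ℝ) + 1) ^ P.d := one_le_pow₀ (by norm_num)
      have hAd : A / (((1 : ℕ) : ℝ) + 1) ^ P.d ≤ A := div_le_self hA0 hden
      have hM2 : M ^ 2 ≤ θ ^ 2 := pow_le_pow_left₀ hM0 hMθ 2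
      exact mul_le_mul hAd hM2 (sq_nonneg _) hA0
    have h2 : E * (((1 : ℕ) : ℝ)) ^ 2 * θ ^ 2 = E * θ ^ 2 := by norm_num
    rw [h2] at h
    have e3 : (A + E) * θ ^ 2 = A * θ ^ 2 + E * θ ^ 2 := by ring
    linarith [h, h1, hT1, hT2, e3]
  · by_cases ht2 : (ℓmax : ℝ) ≤ t
    · -- the largest scale
      have h := step ℓmax hℓmax le_rfl
      have h1 : E * (ℓmax : ℝ) ^ 2 * θ ^ 2 ≤ E * Φ := by
        rw [← hsq, mul_assoc]
        refine mul_le_mul_of_nonneg_left ?_ hE0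
        have hl0 : (0 : ℝ) ≤ ℓmax := by positivity
        exact mul_le_mul_of_nonneg_right (pow_le_pow_left₀ hl0 ht2 2) (sq_nonneg _)
      have e3 : (A + 4 * E) * Φ = A * Φ + 4 * (E * Φ) := by ring
      have hAΦ : 0 ≤ A * Φ := mul_nonneg hA0 hΦ0
      have hEΦ : 0 ≤ E * Φ := mul_nonneg hE0 hΦ0
      linarith [h, h1, hT3, e3, hAΦ, hEΦ]
    · -- the optimal intermediate scale `ℓ = ⌈t⌉`
      have ht1' : 1 < t := lt_of_not_ge ht1
      have ht2' : t < ℓmax := lt_of_not_ge ht2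
      have htpos : 0 < t := lt_trans zero_lt_one ht1'
      set ℓ : ℕ := ⌈t⌉₊ with hℓ
      have hℓ1 : 1 ≤ ℓ := Nat.one_le_iff_ne_zero.mpr (Nat.pos_iff_ne_zero.mp (Nat.ceil_pos.mpr htpos))
      have hℓ2 : ℓ ≤ ℓmax := Nat.ceil_le.mpr ht2'.le
      have hℓt : t ≤ (ℓ : ℝ) := Nat.le_ceil t
      have hℓt' : (ℓ : ℝ) < t + 1 := Nat.ceil_lt_add_one ht0
      have h := step ℓ hℓ1 hℓ2
      -- `M > 0` (since `t > 1` forces `M > θ > 0`)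
      have hMpos : 0 < M := by
        by_contra hM'
        have hM00 : M = 0 := le_antisymm (le_of_not_gt hM') hM0
        have : t = 0 := by
          rw [ht, hM00, zero_div]
          exact Real.zero_rpow (by positivity)
        linarith
      -- mass term: `A/(ℓ+1)^d M² ≤ A·M²/t^d = A·Φ`
      have hdiv : M ^ 2 / t ^ P.d = Φ := by rw [ht, hΦ]; exact rpow_letter_div P.d hθpos hMpos
      have h1 : A / ((ℓ : ℝ) + 1) ^ P.d * M ^ 2 ≤ A * Φ := by
        rw [← hdiv]
        have hpow : t ^ P.d ≤ ((ℓ : ℝ) + 1) ^ P.d := pow_le_pow_left₀ htpos.le (by linarith) _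
        have htd : 0 < t ^ P.d := pow_pos htpos _
        have e1 : A / ((ℓ : ℝ) + 1) ^ P.d * M ^ 2 = A * (M ^ 2 / ((ℓ : ℝ) + 1) ^ P.d) := by ring
        rw [e1]
        refine mul_le_mul_of_nonneg_left ?_ hA0
        exact div_le_div_of_nonneg_left (sq_nonneg _) htd hpow
      -- source term: `E ℓ² θ² ≤ 4E t² θ² = 4E·Φ`
      have h2 : E * (ℓ : ℝ) ^ 2 * θ ^ 2 ≤ 4 * E * Φ := by
        rw [← hsq]
        have hl : (ℓ : ℝ) ^ 2 ≤ 4 * t ^ 2 := by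
          have h2t : (ℓ : ℝ) ≤ 2 * t := by linarith
          have hl0 : (0 : ℝ) ≤ ℓ := by positivity
          have := pow_le_pow_left₀ hl0 h2t 2
          linarith [this, (by ring : (2 * t) ^ 2 = 4 * t ^ 2)]
        have := mul_le_mul_of_nonneg_left (mul_le_mul_of_nonneg_right hl (sq_nonneg θ)) hE0
        linarith
      have e3 : (A + 4 * E) * Φ = A * Φ + 4 * E * Φ := by ring
      linarith [h, h1, h2, hT1, hT3, e3]

end Torus

end Summit.QuantumFields.YangMills.Theorems.PoincareLipschitzInteriorSupScaleOptimised

end
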